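import Summits.NavierStokesRegularity.FluidComputer.AbcCrayaAssembly

/-!
# Cube sections and locality of the certifier's matrix in Craya coordinates; the ASSEMBLY on cubes
(instab3 g5 — implementation 1 of the skew-cut X0 certifier, cell `ns-blowup`, 2026-08-26)

HONEST FRAMING (human ruling D-0035): nothing here is a claim about Navier–Stokes blow-up.
WHAT THIS IS NOT: not NS evidence; MODEL lane; no certificate is used or moved. Sequel of
`CrayaCoordinates` / `AbcCrayaMatrix` / `AbcCrayaAssembly`:

* `crayaCube K = {(k, a) : ‖k‖_∞ ≤ K}` — the index sets of the certifier's Galerkin sections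
  (INSTAB3-METHOD §1 "cube sections `|k|_∞ ≤ K`"; SKEWCUT-CERT (F3)); monotone, exhausting, `F_0 = ∅`;
* **locality (F3)**: the band of a cube-`K` index lies in cube `K + 1`
  (`crayaNbr_subset_crayaCube_succ`), so the matrix couples `F_K` only to `F_{K+1}`
  (`abcCrayaMatrix_eq_zero_of_far`, `sum_abcCrayaMatrix_mul_eq_sum_cube_succ`) — the shell structure
  behind the head/shell/tail block form of `SkewCutSchurCoercivity.exists_eigenvalue_of_certificate`;
* `exists_isLinNSEigenvalue_abcFlow_of_cube_sections`: the ASSEMBLY theorem of `AbcCrayaAssembly`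
  specialised to the sections `F_n = crayaCube (K₀ + n)`;
* `tail_constant_of_not_mem_crayaCube`: the TAIL CONSTANT hypothesis `htail` of
  `SkewCutGalerkinTailForm.not_eigenvalue_of_structure` from the transcribed `MU2 ≤ a + ν(K+2)² − s`
  (outside `F_{K+1}` one has `|k|² ≥ (K+2)²`).

Mathlib + tree files only. New definition (review lane): `crayaCube` (irreducible; use `mem_crayaCube`).
-/

noncomputable section

open scoped BigOperators InnerProductSpace ComplexConjugate Matrix
open Finset Matrix Filter Topology

namespace Summit.NavierStokesRegularity.FluidComputer.CrayaCubes

open Literature.Analysis.FluidPDE Literature.Analysis.FluidPDE.SteadyLattice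
open Literature.Analysis.FunctionSpaces Literature.Analysis.FunctionSpaces.Torus
open Summit.NavierStokesRegularity.FluidComputer.CrayaFrames
open Summit.NavierStokesRegularity.FluidComputer.AbcCrayaMatrix

/-! ### §9 Cube sections and locality (SKEWCUT-CERT (F3)) in Craya coordinates -/

/-- The cube fibres of the Craya index set are finite (finitely many modes per cube `‖k‖_∞ ≤ K`). -/
theorem finite_crayaCubeSet (K : ℕ) : Set.Finite {i : CrayaIdx | ∀ m, |(crayaLab i).1 m| ≤ (K : ℤ)} :=
  SkewCutGalerkinLattice.finite_cube_fibre_of_injective crayaLab crayaLab_injective K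

/-- **The cube sections** `F_K = {(k, a) : ‖k‖_∞ ≤ K}` of the Craya index set — the index sets of the
certifier's Galerkin sections (INSTAB3-METHOD §1: "cube sections `|k|_∞ ≤ K`"). Marked `irreducible`
(use `mem_crayaCube`). -/
@[irreducible] def crayaCube (K : ℕ) : Finset CrayaIdx := (finite_crayaCubeSet K).toFinset

/-- Membership in a cube section. -/
theorem mem_crayaCube {K : ℕ} {i : CrayaIdx} : i ∈ crayaCube K ↔ ∀ m, |i.1.1 m| ≤ (K : ℤ) := by
  rw [crayaCube, Set.Finite.mem_toFinset]
  rfl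

/-- The cube sections are monotone in `K`. -/
theorem crayaCube_mono : Monotone crayaCube := by
  intro a b hab i hi
  rw [mem_crayaCube] at hi ⊢
  exact fun m => (hi m).trans (by exact_mod_cast hab)

/-- The cube sections exhaust the index set. -/
theorem exists_mem_crayaCube (i : CrayaIdx) : ∃ K, i ∈ crayaCube K := by
  refine ⟨∑ m, (i.1.1 m).natAbs, ?_⟩
  rw [mem_crayaCube]
  intro m
  rw [Int.abs_eq_natAbs]
  have : (i.1.1 m).natAbs ≤ ∑ m', (i.1.1 m').natAbs :=
    Finset.single_le_sum (f := fun m' => (i.1.1 m').natAbs) (fun _ _ => Nat.zero_le _) (Finset.mem_univ m)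
  exact_mod_cast this

/-- The empty frequency cube: `F_0 = ∅` (the only frequency with `‖k‖_∞ ≤ 0` is `k = 0`, excluded). -/
theorem crayaCube_zero : crayaCube 0 = ∅ := by
  ext i
  simp only [Finset.notMem_empty, iff_false, mem_crayaCube, Nat.cast_zero, not_forall, not_le]
  by_contra h
  push Not at h
  apply i.1.2
  funext m
  exact abs_nonpos_iff.mp (h m)

/-- **Locality (F3)**: the band of a cube-`K` index lies in the cube `K + 1` — the certifier's matrix
couples the section `F_K` only to `F_{K+1}` (each shell frequency changes one coordinate by `±1`). -/
theorem crayaNbr_subset_crayaCube_succ {K : ℕ} {i : CrayaIdx} (hi : i ∈ crayaCube K) :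
    crayaNbr i ⊆ crayaCube (K + 1) := by
  intro j hj
  obtain ⟨y, hy⟩ := Torus.mem_abcFreq.mp (mem_crayaNbr.mp hj)
  rw [mem_crayaCube] at hi ⊢
  intro m
  have h1 : j.1.1 m = i.1.1 m - Torus.abcDir y m := by
    have := congr_fun hy m; simp only [Pi.sub_apply] at this; linarith
  have h2 : |Torus.abcDir y m| ≤ 1 := by
    rw [Torus.abcDir_apply]
    split_ifs <;> simp
  rw [h1]
  calc |i.1.1 m - Torus.abcDir y m| ≤ |i.1.1 m| + |Torus.abcDir y m| := abs_sub _ _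
    _ ≤ (K : ℤ) + 1 := add_le_add (hi m) h2
    _ = ((K + 1 : ℕ) : ℤ) := by push_cast; ring

/-- Conversely, an index in cube `K` is only reached from the band of indices in cube `K + 1`:
`j ∈ band(i)`, `j ∈ F_K` ⇒ `i ∈ F_{K+1}`. -/
theorem mem_crayaCube_succ_of_mem_crayaNbr {K : ℕ} {i j : CrayaIdx} (hj : j ∈ crayaNbr i)
    (hjK : j ∈ crayaCube K) : i ∈ crayaCube (K + 1) := by
  have h1 : crayaNbr j ⊆ crayaCube (K + 1) := crayaNbr_subset_crayaCube_succ hjK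
  have h2 : i ∈ crayaNbr j := by
    rw [mem_crayaNbr] at hj ⊢
    simpa using Torus.neg_mem_abcFreq _ hj
  exact h1 h2

/-- No coupling from cube `K` out of cube `K + 1`: `A_{ij} = 0` for `i ∈ F_K`, `j ∉ F_{K+1}`. -/
theorem abcCrayaMatrix_eq_zero_of_far_right (A B C : ℝ) {K : ℕ} {i j : CrayaIdx}
    (hi : i ∈ crayaCube K) (hj : j ∉ crayaCube (K + 1)) : abcCrayaMatrix A B C i j = 0 :=
  abcCrayaMatrix_eq_zero_of_not_mem A B C fun h => hj (crayaNbr_subset_crayaCube_succ hi h)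

/-- No coupling into cube `K` from outside cube `K + 1`: `A_{ji} = 0` for `i ∈ F_K`, `j ∉ F_{K+1}`. -/
theorem abcCrayaMatrix_eq_zero_of_far_left (A B C : ℝ) {K : ℕ} {i j : CrayaIdx}
    (hi : i ∈ crayaCube K) (hj : j ∉ crayaCube (K + 1)) : abcCrayaMatrix A B C j i = 0 := by
  have h2 : i ∉ crayaNbr j := by
    intro h
    have h3 : j ∈ crayaCube (K + 1) := mem_crayaCube_succ_of_mem_crayaNbr h hi
    exact hj h3
  exact abcCrayaMatrix_eq_zero_of_not_mem A B C h2

/-- **No coupling across two shells** (SKEWCUT-CERT (F3) locality): entries between cube `K` and the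
complement of cube `K + 1` vanish both ways. -/
theorem abcCrayaMatrix_eq_zero_of_far (A B C : ℝ) {K : ℕ} {i j : CrayaIdx}
    (hi : i ∈ crayaCube K) (hj : j ∉ crayaCube (K + 1)) :
    abcCrayaMatrix A B C i j = 0 ∧ abcCrayaMatrix A B C j i = 0 :=
  ⟨abcCrayaMatrix_eq_zero_of_far_right A B C hi hj, abcCrayaMatrix_eq_zero_of_far_left A B C hi hj⟩

/-- The row action of a cube-`K` index on a family needs only the family on cube `K + 1`
(sections: `(A v)_i = (A (v·1_{F_{K+1}}))_i` for `i ∈ F_K`). -/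
theorem sum_abcCrayaMatrix_mul_eq_sum_cube_succ (A B C : ℝ) (v : CrayaIdx → ℂ) {K : ℕ} {i : CrayaIdx}
    (hi : i ∈ crayaCube K) :
    ∑ j ∈ crayaNbr i, abcCrayaMatrix A B C i j * v j =
      ∑ j ∈ crayaCube (K + 1), abcCrayaMatrix A B C i j * v j :=
  Finset.sum_subset (crayaNbr_subset_crayaCube_succ hi) fun j _ hj => by
    rw [abcCrayaMatrix_eq_zero_of_not_mem A B C hj, zero_mul]

/-- **ASSEMBLY on cube sections.** `AbcCrayaAssembly.exists_isLinNSEigenvalue_abcFlow_of_craya_sections`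
with the certifier's sections `F_n = crayaCube (K₀ + n)` (monotone and exhausting by `crayaCube_mono`,
`exists_mem_crayaCube`): normalised eigenpairs of the cube sections `[−ν|k_i|² δ_ij + A_ij]_{F_{K₀+n}}`
in `[a, e]` with a uniform graph bound, plus Theorem 1′(a) at the ends, give a classical eigenvalue
`2πλ`, `λ ∈ (a, e)`, of the unit-torus linearisation about `abcFlow A B C` (viscosity `ν/(2π)`).
MODEL statement; not NS. -/
theorem exists_isLinNSEigenvalue_abcFlow_of_cube_sections (A B C : ℝ) {ν : ℝ} (hν : 0 < ν)
    {H : Type*} [NormedAddCommGroup H] [InnerProductSpace ℂ H] [CompleteSpace H]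
    (b : HilbertBasis CrayaIdx ℂ H) (x₀ : ℝ) (hx₀ : 1 ≤ x₀)
    (hxK : (12 * (9 * (|A| + |B| + |C|) * Real.sqrt (1 + ν⁻¹))) ^ 2 < x₀)
    (d : lp (fun _ : CrayaIdx => ℂ) ⊤)
    (hdform : ∀ i : CrayaIdx, d i = (((x₀ - -(ν * freqNormSq i.1.1))⁻¹ : ℝ) : ℂ))
    (hd : ∀ i : CrayaIdx, d i * ((x₀ : ℂ) - ((-(ν * freqNormSq i.1.1) : ℝ) : ℂ)) = 1)
    (hd0 : Tendsto (fun i => ‖d i‖) cofinite (𝓝 0))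
    (K₀ : ℕ) (c : ℕ → CrayaIdx → ℂ) (xs : ℕ → ℝ) {a e : ℝ} (hxs : ∀ n, xs n ∈ Set.Icc a e)
    (heig : ∀ n, ∀ i ∈ crayaCube (K₀ + n), ((-(ν * freqNormSq i.1.1) : ℝ) : ℂ) * c n i +
      ∑ j ∈ crayaCube (K₀ + n), abcCrayaMatrix A B C i j * c n j = (xs n : ℂ) * c n i)
    (hnorm : ∀ n, ∑ j ∈ crayaCube (K₀ + n), ‖c n j‖ ^ 2 = 1) {Cg : ℝ} (hCg : 0 ≤ Cg)
    (hgraph : ∀ n, ∑ j ∈ crayaCube (K₀ + n),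
      ‖((x₀ : ℂ) - ((-(ν * freqNormSq j.1.1) : ℝ) : ℂ)) * c n j‖ ^ 2 ≤ Cg ^ 2)
    (hinj : ∀ T : H →L[ℂ] H, (∀ i j, ⟪b i, T (b j)⟫_ℂ = abcCrayaMatrix A B C i j * d j) →
      (∀ x i, ⟪b i, T x⟫_ℂ = ∑' j, (abcCrayaMatrix A B C i j * d j) * ⟪b j, x⟫_ℂ) →
      (∀ (x : H) i, Summable fun j => (abcCrayaMatrix A B C i j * d j) * ⟪b j, x⟫_ℂ) →
      (∀ T' : H →L[ℂ] H, (∀ i j, ⟪b i, T' (b j)⟫_ℂ = abcCrayaMatrix A B C i j * d j) → T' = T) →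
      (∀ w, ((1 : H →L[ℂ] H) - T - ((x₀ : ℂ) - (a : ℂ)) • b.diagonalCLM d) w = 0 → w = 0) ∧
      (∀ w, ((1 : H →L[ℂ] H) - T - ((x₀ : ℂ) - (e : ℂ)) • b.diagonalCLM d) w = 0 → w = 0)) :
    ∃ lam ∈ Set.Ioo a e,
      Torus.IsLinNSEigenvalue (ν / (2 * Real.pi)) (Torus.abcFlow A B C) (2 * Real.pi * lam) :=
  AbcCrayaAssembly.exists_isLinNSEigenvalue_abcFlow_of_craya_sections A B C hν b x₀ hx₀ hxK d hdform hd hd0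
    (fun n => crayaCube (K₀ + n)) (fun m n hmn => crayaCube_mono (Nat.add_le_add_left hmn K₀))
    (fun i => by
      obtain ⟨K, hK⟩ := exists_mem_crayaCube i
      exact ⟨K, crayaCube_mono (Nat.le_add_left K K₀) hK⟩)
    c xs hxs heig hnorm hCg hgraph hinj

/-- Outside the cube `F_K` some coordinate exceeds `K`, hence `|k|² ≥ (K + 1)²`. -/
theorem sq_le_freqNormSq_of_not_mem_crayaCube {K : ℕ} {i : CrayaIdx} (hi : i ∉ crayaCube K) :
    ((K : ℝ) + 1) ^ 2 ≤ freqNormSq i.1.1 := by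
  rw [mem_crayaCube] at hi
  push Not at hi
  obtain ⟨m, hm⟩ := hi
  have hm' : (K : ℤ) + 1 ≤ |i.1.1 m| := by omega
  have hmR : (K : ℝ) + 1 ≤ |((i.1.1 m : ℤ) : ℝ)| := by
    rw [← Int.cast_abs]; exact_mod_cast hm'
  have hsq : ((K : ℝ) + 1) ^ 2 ≤ ((i.1.1 m : ℤ) : ℝ) ^ 2 := by
    rw [← sq_abs ((i.1.1 m : ℤ) : ℝ)]
    exact pow_le_pow_left₀ (by positivity) hmR 2
  rw [freqNormSq]
  exact hsq.trans (Finset.single_le_sum (f := fun m' => ((i.1.1 m' : ℤ) : ℝ) ^ 2)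
    (fun _ _ => sq_nonneg _) (Finset.mem_univ m))

/-- **The TAIL CONSTANT beyond the shell** (hypothesis `htail` of
`SkewCutGalerkinTailForm.not_eigenvalue_of_structure` for the Craya instantiation): from the
certificate's (transcribed) inequality `MU2 ≤ a + ν (K + 2)² − s` (`ν ≥ 0`), every index outside the
cube `F_{K+1}` — i.e. in the shells `≥ K + 2` — satisfies `MU2 ≤ a − ℓ_i − s`, `ℓ_i = −ν|k_i|²`. -/
theorem tail_constant_of_not_mem_crayaCube {ν a s MU2 : ℝ} (hν : 0 ≤ ν) {K : ℕ}
    (htail : MU2 ≤ a + ν * ((K : ℝ) + 2) ^ 2 - s) {i : CrayaIdx} (hi : i ∉ crayaCube (K + 1)) :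
    MU2 ≤ a - -(ν * freqNormSq i.1.1) - s := by
  have h := sq_le_freqNormSq_of_not_mem_crayaCube hi
  push_cast at h
  have h2 : ν * ((K : ℝ) + 2) ^ 2 ≤ ν * freqNormSq i.1.1 :=
    mul_le_mul_of_nonneg_left (by nlinarith [h]) hν
  linarith

end Summit.NavierStokesRegularity.FluidComputer.CrayaCubes

end
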